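import Literature.AnabelianGeometry.EtaleTheta.Discharge.Sec1Thm110iiiProducedDatumTransport
import Literature.AnabelianGeometry.EtaleTheta.Discharge.Sec1Def17Coverings
import HarnessLib

/-!
# [EtTh] Thm. 1.10 (iii) at the produced cusp data — the β-SIDE `ε_±`-data {`Γ₀β`, `g₁β ∉ Π^tp_Ċβ`} TRANSPORTED from the
# α-side along the Prop. 1.8 extension `Γ` (proof-only)

S. Mochizuki, *The étale theta function …* [EtTh], Publ. RIMS **45** (2009), Thm. 1.10 (iii) p. 30 (printed 256), Prop. 1.8 p. 28,
Def. 1.7 p. 27 [cite: MochizukiEtTh2009, Thm 1.10 (iii) p.30]. Layer L2 of the abc-iut cell, node EtTh:Thm1.10(iii); seat abc-iut-L2-t1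
(gen 12; abc-iut-L2-lead R1316 «T110III-β-SIDE»). PROOF-ONLY (no `def`, no instance, no `Prop` fact) over abc-iut-w5-d029's
`Sec1Thm110iiiProducedDatumTransport` (p494291: `thm110iiiGalSect_ofStructureGroupIso_of_decompTransport` ⟸ {(x₀) plain X-level transport,
F-0007, **β-side** {`Γ₀`, `g₁ := inclX(Γ₀)·ε_± ∉ Π^tp_Ċβ`}, (b3)}), abc-iut-L2-t5's `mem_range_inclX_or_mul_epsPM_inv_mem` / `CLevelData.conjFun`,
abc-iut-L6-t1's `dotC_normal` — BY NAME.

WHY. The residual of record (R1117) displays the `ε_±`-data on the β-SIDE, i.e. on the TARGET of `γ`; the α-side datum is the one a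
consumer holds. This file shows the β-side pair is the α-side pair TRANSPORTED along `Γ : Π^tp_{Cα} →̃ Π^tp_{Cβ}` (the extension of `γ`
of Prop. 1.8 carried by `Thm110Hypothesis`, with `PreservesCoverings`): pure group algebra in `Π^tp_{Cβ}`.
* `Thm110Hypothesis.exists_map_epsPM_eq` — `Γ(ε_±α) = inclX(m)·ε_±β` for some `m ∈ Π^tp_{Xβ}` (`ε_±α ∉ Π^tp_{Xα}`, `Γ(Π^tp_{Xα}) = Π^tp_{Xβ}`,
  `[Π^tp_C : Π^tp_X] = 2`);
* `Thm110Hypothesis.epsPM_conj_of_alphaSide` — from the X-level transport `γ_X(D_{xα}) = k·D_{xβ}·k⁻¹` and the α-side law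
  `ε_±α·inclX(d)·ε_±α⁻¹ = inclX(Γ₀α⁻¹ d Γ₀α)` on `D_{xα}`, the β-side law holds with **`Γ₀β := k⁻¹·γ_X(Γ₀α·jα)·m`**,
  `jα := CLevelData.conjFun ε_±α (γ_X⁻¹ k)`;
* `Thm110Hypothesis.inclX_gamma0_mul_epsPM` — then `g₁β = inclX(k)⁻¹·Γ(g₁α)·inclX(k)`, so (`Π^tp_Ċ ⊴ Π^tp_C`, `Γ(Π^tp_{Ċα}) = Π^tp_{Ċβ}`)
  `Thm110Hypothesis.not_mem_dotC_of_alphaSide` — `g₁α ∉ Π^tp_{Ċα} ⇒ g₁β ∉ Π^tp_{Ċβ}`;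
* **`thm110iiiGalSect_ofStructureGroupIso_of_alphaSide`** / **`…_of_isoPreservesCuspidalDecomp_alphaSide`** — Thm. 1.10 (iii) AS TYPED at the two
  produced data with the `ε_±`-data on the α-SIDE only: ⟸ {(x₀) / [SemiAnbd] Thm. 6.5 (iii) + C16, F-0007 ([AbsAnab] Lem. 1.3.8),
  α-side {`Γ₀α`, `g₁α ∉ Π^tp_{Ċα}`}, (b3)}.
HONEST FRAMING: inputs are cited anabelian results carried BY NAME, none asserted; «AS TYPED» as in p494291; typed ≠ proved; no side is taken on
[IUTchIII] Cor. 3.12, on which nothing here bears.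
-/

namespace Literature.AnabelianGeometry.EtaleTheta

open Literature.AnabelianGeometry.SemiGraphs Literature.AnabelianGeometry.AbsoluteAnabelian GalSect
open MuTwoSetting MuTwoSetting.DotCCusp
open scoped Pointwise

/-! ### Transport of the `ε_±`-data along `Γ` -/

namespace Thm110Hypothesis

variable {p : ℕ} [Fact p.Prime] {Mα Mβ : MuTwoSetting p} {εα : Mα.GtpC} {εβ : Mβ.GtpC}
  {hCα : Mα.toThetaSetting.Compat} {hCβ : Mβ.toThetaSetting.Compat}
  {Eα : Mα.toThetaSetting.EtaleThetaData} {Eβ : Mβ.toThetaSetting.EtaleThetaData}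
  {γ : Mα.dotC εα ≃ₜ* Mβ.dotC εβ} (H : Thm110Hypothesis εα εβ hCα hCβ Eα Eβ γ)

/-- `Γ ∘ inclX = inclX ∘ γ_X` (field `γX_spec`, pointwise). [cite: MochizukiEtTh2009, Prop 1.8 p.28] -/
theorem map_inclX (x : Mα.PiTemp) : H.Γ (Mα.inclX x) = Mβ.inclX (H.γX x) := (H.γX_spec x).symm

/-- **`Γ(ε_±α) = inclX(m)·ε_±β`** for some `m ∈ Π^tp_{Xβ}`: `Γ` carries `Π^tp_{Xα}` onto `Π^tp_{Xβ}` (`PreservesCoverings.map_X`),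
`ε_±α ∉ Π^tp_{Xα}`, and `Π^tp_{Cβ} = Π^tp_{Xβ} ⊔ Π^tp_{Xβ}·ε_±β` (index `2`). [cite: MochizukiEtTh2009, Prop 1.8 p.28] -/
theorem exists_map_epsPM_eq : ∃ m : Mβ.PiTemp, H.Γ Mα.epsPM = Mβ.inclX m * Mβ.epsPM := by
  rcases Mβ.mem_range_inclX_or_mul_epsPM_inv_mem (H.Γ Mα.epsPM) with hmem | ⟨m, hm⟩
  · exfalso
    rw [← H.preserves.map_X] at hmem
    obtain ⟨g, hg, hgε⟩ := hmem
    have : g = Mα.epsPM := H.Γ.injective hgε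
    exact Mα.epsPM_not_mem (this ▸ hg)
  · exact ⟨m, by rw [hm, inv_mul_cancel_right]⟩

/-- `ε_±·inclX(x)·ε_±⁻¹ = inclX(CLevelData.conjFun ε_± x)` (`Π^tp_X ⊴ Π^tp_C`). [cite: MochizukiEtTh2009, Def 1.7 p.27] -/
theorem epsPM_conj_inclX (M : MuTwoSetting p) (x : M.PiTemp) :
    M.epsPM * M.inclX x * M.epsPM⁻¹ = M.inclX (CLevelData.conjFun M.epsPM x) := (CLevelData.inclX_conjFun M.epsPM x).symm

/-- **The β-side `ε_±`-law from the α-side one.** From `γ_X(D_{xα}) = k·D_{xβ}·k⁻¹`, `ε_±α inclX(d) ε_±α⁻¹ = inclX(Γ₀α⁻¹ d Γ₀α)` on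
`D_{xα}` and `Γ(ε_±α) = inclX(m)·ε_±β`: `ε_±β inclX(d) ε_±β⁻¹ = inclX(Γ₀β⁻¹ d Γ₀β)` on `D_{xβ}` for
`Γ₀β := k⁻¹·γ_X(Γ₀α·CLevelData.conjFun ε_±α (γ_X⁻¹ k))·m`. [cite: MochizukiEtTh2009, Thm 1.10 (iii) p.30] -/
theorem epsPM_conj_of_alphaSide {xα : Mα.Pt} {xβ : Mβ.Pt} {k : Mβ.PiTemp}
    (hX0 : (Mα.decomp xα).map H.γX.toMulEquiv.toMonoidHom = MulAut.conj k • Mβ.decomp xβ)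
    {Γ₀ : Mα.PiTemp} (hΓ₀ : ∀ d ∈ Mα.decomp xα, Mα.epsPM * Mα.inclX d * Mα.epsPM⁻¹ = Mα.inclX (Γ₀⁻¹ * d * Γ₀))
    {m : Mβ.PiTemp} (hm : H.Γ Mα.epsPM = Mβ.inclX m * Mβ.epsPM) :
    ∀ d ∈ Mβ.decomp xβ, Mβ.epsPM * Mβ.inclX d * Mβ.epsPM⁻¹ =
      Mβ.inclX ((k⁻¹ * H.γX (Γ₀ * CLevelData.conjFun Mα.epsPM (H.γX.symm k)) * m)⁻¹ * d *
        (k⁻¹ * H.γX (Γ₀ * CLevelData.conjFun Mα.epsPM (H.γX.symm k)) * m)) := by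
  intro d hd
  -- `k d k⁻¹ = γ_X(dα)` with `dα ∈ D_{xα}`
  have hkd : k * d * k⁻¹ ∈ (Mα.decomp xα).map H.γX.toMulEquiv.toMonoidHom := by
    rw [hX0]
    exact ⟨d, hd, rfl⟩
  obtain ⟨dα, hdα, hγd⟩ := hkd
  change H.γX dα = k * d * k⁻¹ at hγd
  have hdeq : d = H.γX ((H.γX.symm k)⁻¹ * dα * H.γX.symm k) := by
    rw [map_mul, map_mul, map_inv, hγd, ContinuousMulEquiv.apply_symm_apply]; group
  have hε : Mβ.epsPM = (Mβ.inclX m)⁻¹ * H.Γ Mα.epsPM := by rw [hm, inv_mul_cancel_left]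
  -- the α-side computation pushed through `Γ`
  have key : H.Γ Mα.epsPM * Mβ.inclX (H.γX ((H.γX.symm k)⁻¹ * dα * H.γX.symm k)) * (H.Γ Mα.epsPM)⁻¹ =
      Mβ.inclX (H.γX ((Γ₀ * CLevelData.conjFun Mα.epsPM (H.γX.symm k))⁻¹ * dα *
        (Γ₀ * CLevelData.conjFun Mα.epsPM (H.γX.symm k)))) := by
    rw [← H.map_inclX, ← H.map_inclX, ← map_inv H.Γ, ← map_mul, ← map_mul]
    congr 1
    have h1 : Mα.epsPM * ((Mα.inclX (H.γX.symm k))⁻¹ * Mα.inclX dα * Mα.inclX (H.γX.symm k)) * Mα.epsPM⁻¹ =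
        (Mα.epsPM * Mα.inclX (H.γX.symm k) * Mα.epsPM⁻¹)⁻¹ * (Mα.epsPM * Mα.inclX dα * Mα.epsPM⁻¹) *
          (Mα.epsPM * Mα.inclX (H.γX.symm k) * Mα.epsPM⁻¹) := by group
    rw [map_mul, map_mul, map_inv, h1, hΓ₀ dα hdα, epsPM_conj_inclX, ← map_inv, ← map_mul, ← map_mul]
    congr 1
    group
  rw [hdeq, hε]
  calc (Mβ.inclX m)⁻¹ * H.Γ Mα.epsPM * Mβ.inclX (H.γX ((H.γX.symm k)⁻¹ * dα * H.γX.symm k)) *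
        ((Mβ.inclX m)⁻¹ * H.Γ Mα.epsPM)⁻¹
      = (Mβ.inclX m)⁻¹ * (H.Γ Mα.epsPM * Mβ.inclX (H.γX ((H.γX.symm k)⁻¹ * dα * H.γX.symm k)) *
          (H.Γ Mα.epsPM)⁻¹) * Mβ.inclX m := by group
    _ = (Mβ.inclX m)⁻¹ * Mβ.inclX (H.γX ((Γ₀ * CLevelData.conjFun Mα.epsPM (H.γX.symm k))⁻¹ * dα *
          (Γ₀ * CLevelData.conjFun Mα.epsPM (H.γX.symm k)))) * Mβ.inclX m := by rw [key]
    _ = Mβ.inclX ((k⁻¹ * H.γX (Γ₀ * CLevelData.conjFun Mα.epsPM (H.γX.symm k)) * m)⁻¹ *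
          H.γX ((H.γX.symm k)⁻¹ * dα * H.γX.symm k) *
          (k⁻¹ * H.γX (Γ₀ * CLevelData.conjFun Mα.epsPM (H.γX.symm k)) * m)) := by
        rw [← map_inv Mβ.inclX, ← map_mul, ← map_mul]
        congr 1
        simp only [map_mul, map_inv, ContinuousMulEquiv.apply_symm_apply]
        group

/-- **`g₁β = inclX(k)⁻¹·Γ(g₁α)·inclX(k)`** for `g₁ := inclX(Γ₀)·ε_±` and the transported `Γ₀β`. [cite: MochizukiEtTh2009, Thm 1.10 (iii) p.30] -/
theorem inclX_gamma0_mul_epsPM (k : Mβ.PiTemp) (Γ₀ : Mα.PiTemp) {m : Mβ.PiTemp} (hm : H.Γ Mα.epsPM = Mβ.inclX m * Mβ.epsPM) :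
    Mβ.inclX (k⁻¹ * H.γX (Γ₀ * CLevelData.conjFun Mα.epsPM (H.γX.symm k)) * m) * Mβ.epsPM =
      (Mβ.inclX k)⁻¹ * H.Γ (Mα.inclX Γ₀ * Mα.epsPM) * Mβ.inclX k := by
  have hε : Mβ.inclX m * Mβ.epsPM = H.Γ Mα.epsPM := hm.symm
  have hj : Mβ.inclX (H.γX (CLevelData.conjFun Mα.epsPM (H.γX.symm k))) = H.Γ Mα.epsPM * Mβ.inclX k * (H.Γ Mα.epsPM)⁻¹ := by
    rw [← H.map_inclX, CLevelData.inclX_conjFun, map_mul, map_mul, map_inv, H.map_inclX, ContinuousMulEquiv.apply_symm_apply]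
  rw [map_mul, map_mul, map_inv, map_mul H.γX, map_mul Mβ.inclX, hj, map_mul H.Γ, ← H.map_inclX Γ₀, mul_assoc _ (Mβ.inclX m),
    hε]
  group

/-- **`g₁α ∉ Π^tp_{Ċα} ⇒ g₁β ∉ Π^tp_{Ċβ}`** (`Π^tp_Ċ ⊴ Π^tp_C` — abc-iut-L6-t1's `dotC_normal` — and `Γ(Π^tp_{Ċα}) = Π^tp_{Ċβ}`).
[cite: MochizukiEtTh2009, Def 1.7 p.27] -/
theorem not_mem_dotC_of_alphaSide (k : Mβ.PiTemp) {Γ₀ : Mα.PiTemp} (hnot : Mα.inclX Γ₀ * Mα.epsPM ∉ Mα.dotC εα)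
    {m : Mβ.PiTemp} (hm : H.Γ Mα.epsPM = Mβ.inclX m * Mβ.epsPM) :
    Mβ.inclX (k⁻¹ * H.γX (Γ₀ * CLevelData.conjFun Mα.epsPM (H.γX.symm k)) * m) * Mβ.epsPM ∉ Mβ.dotC εβ := by
  rw [H.inclX_gamma0_mul_epsPM k Γ₀ hm]
  intro hmem
  haveI := Mβ.dotC_normal εβ
  have h1 : H.Γ (Mα.inclX Γ₀ * Mα.epsPM) ∈ Mβ.dotC εβ := by
    have := (Mβ.dotC_normal εβ).conj_mem _ hmem (Mβ.inclX k)
    rwa [← mul_assoc, ← mul_assoc, mul_inv_cancel, one_mul, mul_assoc, mul_inv_cancel, mul_one] at this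
  rw [← H.preserves.map_dotC] at h1
  obtain ⟨g, hg, hgΓ⟩ := h1
  exact hnot ((H.Γ.injective hgΓ) ▸ hg)

end Thm110Hypothesis

/-! ### Thm. 1.10 (iii) at the produced data with the `ε_±`-data on the α-SIDE -/

section ProducedTransportAlpha


variable {p : ℕ} [Fact p.Prime] {Mα Mβ : MuTwoSetting p} {εα : Mα.GtpC} {εβ : Mβ.GtpC}
  {hCα : Mα.toThetaSetting.Compat} {hCβ : Mβ.toThetaSetting.Compat}
  {Eα : Mα.toThetaSetting.EtaleThetaData} {Eβ : Mβ.toThetaSetting.EtaleThetaData}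
  {γ : Mα.dotC εα ≃ₜ* Mβ.dotC εβ} [T1Space Mα.GtpC] [T1Space Mβ.GtpC]
  (H : Thm110Hypothesis εα εβ hCα hCβ Eα Eβ γ)
  (Sα : Mα.StandardData Eα.toKummerData) (Sβ : Mβ.StandardData Eβ.toKummerData)
  -- the produced cusp data, sides α and β
  (eα : Mα.CLevelData) {xα : Mα.Pt} (hxα : Mα.IsCusp xα) (hDα : Mα.decomp xα ≤ Mα.GtpXdd)
  {S₀α : Subgroup Mα.PiTemp} (hS₀α : S₀α ∈ (cuspPairOf Mα.toTemperedCurve xα).splittings)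
  (κα : haveI := isMulCommutative_pushforward_I eα hxα
    haveI := ((cuspPairOf Mα.toTemperedCurve xα).pushforward Mα.inclX).ID_normal
    KxHat Mα.toTemperedCurve ≃*
      ↥(ContH1.resKer ((cuspPairOf Mα.toTemperedCurve xα).pushforward Mα.inclX).ID
        (⊤ : Subgroup ((cuspPairOf Mα.toTemperedCurve xα).pushforward Mα.inclX).D)
        (((cuspPairOf Mα.toTemperedCurve xα).pushforward Mα.inclX).isClosedComplement_of_mem_splittings
          (map_inclX_mem_splittings eα hS₀α)).le_left))
  (eβ : Mβ.CLevelData) {xβ : Mβ.Pt} (hxβ : Mβ.IsCusp xβ) (hDβ : Mβ.decomp xβ ≤ Mβ.GtpXdd)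
  {S₀β : Subgroup Mβ.PiTemp} (hS₀β : S₀β ∈ (cuspPairOf Mβ.toTemperedCurve xβ).splittings)
  (κβ : haveI := isMulCommutative_pushforward_I eβ hxβ
    haveI := ((cuspPairOf Mβ.toTemperedCurve xβ).pushforward Mβ.inclX).ID_normal
    KxHat Mβ.toTemperedCurve ≃*
      ↥(ContH1.resKer ((cuspPairOf Mβ.toTemperedCurve xβ).pushforward Mβ.inclX).ID
        (⊤ : Subgroup ((cuspPairOf Mβ.toTemperedCurve xβ).pushforward Mβ.inclX).D)
        (((cuspPairOf Mβ.toTemperedCurve xβ).pushforward Mβ.inclX).isClosedComplement_of_mem_splittings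
          (map_inclX_mem_splittings eβ hS₀β)).le_left))


/-- **Thm. 1.10 (iii) AS TYPED at the two produced data, `ε_±`-data on the α-SIDE**: abc-iut-w5-d029's
`thm110iiiGalSect_ofStructureGroupIso_of_decompTransport` with its β-side pair {`Γ₀`, `g₁ ∉ Π^tp_Ċβ`} TRANSPORTED from the α-side
along `Γ`. ⟸ {(x₀) the plain X-level transport `γ_X(D_{xα}) = k·D_{xβ}·k⁻¹` · (ΔX) = F-0007 [AbsAnab] Lem. 1.3.8 BY NAME · α-side
`ε_±`-data {`Γ₀α`, `g₁α := inclX(Γ₀α)·ε_±α ∉ Π^tp_{Ċα}`} (used only in the cusp-swapping case) · (b3)}. [cite: MochizukiEtTh2009, Thm 1.10 (iii) p.30] -/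
theorem thm110iiiGalSect_ofStructureGroupIso_of_alphaSide
    {k : Mβ.PiTemp} (hX0 : (Mα.decomp xα).map H.γX.toMulEquiv.toMonoidHom = MulAut.conj k • Mβ.decomp xβ)
    {Γ₀ : Mα.PiTemp} (hΓ₀ : ∀ d ∈ Mα.decomp xα, Mα.epsPM * Mα.inclX d * Mα.epsPM⁻¹ = Mα.inclX (Γ₀⁻¹ * d * Γ₀))
    (hnot : Mα.inclX Γ₀ * Mα.epsPM ∉ Mα.dotC εα)
    (Fα Fβ : Literature.AnabelianGeometry.AbsoluteAnabelian.FundamentalExtension.{0})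
    (fα : Fα.arith ≃ₜ* Mα.PiHat) (fβ : Fβ.arith ≃ₜ* Mβ.PiHat)
    (hfα : Fα.geom.map fα.toMulEquiv.toMonoidHom = Mα.DeltaHat) (hfβ : Fβ.geom.map fβ.toMulEquiv.toMonoidHom = Mβ.DeltaHat)
    (h138 : ∀ Φ : Mα.PiHat ≃ₜ* Mβ.PiHat, (∀ y : Mα.PiTemp, Φ (Mα.toHat y) = Mβ.toHat (H.γX y)) →
      Literature.AnabelianGeometry.AbsoluteAnabelian.FundamentalExtension.PreservesGeom (F := Fβ) (fα.trans (Φ.trans fβ.symm)))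
    (hecan : ∀ c ∈ Mβ.dotC εβ,
      ∀ (t : (ofStructureGroupIso eα εα hxα hDα hS₀α κα).pair.SplittingClass →
        (ofStructureGroupIso eβ εβ hxβ hDβ hS₀β κβ).pair.SplittingClass),
      (∀ (S : Subgroup Mα.GtpC) (hS : S ∈ (ofStructureGroupIso eα εα hxα hDα hS₀α κα).pair.splittings),
        ∃ h', t (GalSect.CuspPair.SplittingClass.mk (ofStructureGroupIso eα εα hxα hDα hS₀α κα).pair S hS) =
          GalSect.CuspPair.SplittingClass.mk (ofStructureGroupIso eβ εβ hxβ hDβ hS₀β κβ).pair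
            (S.map (H.Γ.trans (Mβ.innerAutC c)).toMulEquiv.toMonoidHom) h') →
      t '' (ofStructureGroupIso eα εα hxα hDα hS₀α κα).canonical ⊆ (ofStructureGroupIso eβ εβ hxβ hDβ hS₀β κβ).canonical) :
    Thm110iiiGalSect H Sα Sβ (ofStructureGroupIso eα εα hxα hDα hS₀α κα) (ofStructureGroupIso eβ εβ hxβ hDβ hS₀β κβ) := by
  obtain ⟨m, hm⟩ := H.exists_map_epsPM_eq
  exact thm110iiiGalSect_ofStructureGroupIso_of_decompTransport H Sα Sβ eα hxα hDα hS₀α κα eβ hxβ hDβ hS₀β κβ hX0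
    (H.epsPM_conj_of_alphaSide hX0 hΓ₀ hm) (H.not_mem_dotC_of_alphaSide k hnot hm) Fα Fβ fα fβ hfα hfβ h138 hecan

/-- **Thm. 1.10 (iii) AS TYPED at the produced data, (x₀) BY NAME and the `ε_±`-data on the α-SIDE**: ⟸ {[SemiAnbd] Thm. 6.5 (iii)
(`IsoPreservesCuspidalDecomp`) + the uniqueness of the cusp of `Xβ` (C16) · F-0007 · α-side {`Γ₀α`, `g₁α ∉ Π^tp_{Ċα}`} · (b3)} — the node's
residual with NO β-side model datum. [cite: MochizukiEtTh2009, Thm 1.10 (iii) p.30] -/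
theorem thm110iiiGalSect_ofStructureGroupIso_of_isoPreservesCuspidalDecomp_alphaSide
    (h65 : Mα.toThetaSetting.toTemperedCurve.IsoPreservesCuspidalDecomp Mβ.toThetaSetting.toTemperedCurve)
    (huniq : ∀ x' : Mβ.Pt, Mβ.IsCusp x' → x' = xβ)
    {Γ₀ : Mα.PiTemp} (hΓ₀ : ∀ d ∈ Mα.decomp xα, Mα.epsPM * Mα.inclX d * Mα.epsPM⁻¹ = Mα.inclX (Γ₀⁻¹ * d * Γ₀))
    (hnot : Mα.inclX Γ₀ * Mα.epsPM ∉ Mα.dotC εα)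
    (Fα Fβ : Literature.AnabelianGeometry.AbsoluteAnabelian.FundamentalExtension.{0})
    (fα : Fα.arith ≃ₜ* Mα.PiHat) (fβ : Fβ.arith ≃ₜ* Mβ.PiHat)
    (hfα : Fα.geom.map fα.toMulEquiv.toMonoidHom = Mα.DeltaHat) (hfβ : Fβ.geom.map fβ.toMulEquiv.toMonoidHom = Mβ.DeltaHat)
    (h138 : ∀ Φ : Mα.PiHat ≃ₜ* Mβ.PiHat, (∀ y : Mα.PiTemp, Φ (Mα.toHat y) = Mβ.toHat (H.γX y)) →
      Literature.AnabelianGeometry.AbsoluteAnabelian.FundamentalExtension.PreservesGeom (F := Fβ) (fα.trans (Φ.trans fβ.symm)))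
    (hecan : ∀ c ∈ Mβ.dotC εβ,
      ∀ (t : (ofStructureGroupIso eα εα hxα hDα hS₀α κα).pair.SplittingClass →
        (ofStructureGroupIso eβ εβ hxβ hDβ hS₀β κβ).pair.SplittingClass),
      (∀ (S : Subgroup Mα.GtpC) (hS : S ∈ (ofStructureGroupIso eα εα hxα hDα hS₀α κα).pair.splittings),
        ∃ h', t (GalSect.CuspPair.SplittingClass.mk (ofStructureGroupIso eα εα hxα hDα hS₀α κα).pair S hS) =
          GalSect.CuspPair.SplittingClass.mk (ofStructureGroupIso eβ εβ hxβ hDβ hS₀β κβ).pair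
            (S.map (H.Γ.trans (Mβ.innerAutC c)).toMulEquiv.toMonoidHom) h') →
      t '' (ofStructureGroupIso eα εα hxα hDα hS₀α κα).canonical ⊆ (ofStructureGroupIso eβ εβ hxβ hDβ hS₀β κβ).canonical) :
    Thm110iiiGalSect H Sα Sβ (ofStructureGroupIso eα εα hxα hDα hS₀α κα) (ofStructureGroupIso eβ εβ hxβ hDβ hS₀β κβ) := by
  obtain ⟨k, hX0⟩ := exists_conj_decomp_eq_of_isoPreservesCuspidalDecomp H hxα h65 huniq
  exact thm110iiiGalSect_ofStructureGroupIso_of_alphaSide H Sα Sβ eα hxα hDα hS₀α κα eβ hxβ hDβ hS₀β κβ hX0 hΓ₀ hnot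
    Fα Fβ fα fβ hfα hfβ h138 hecan

end ProducedTransportAlpha

end Literature.AnabelianGeometry.EtaleTheta
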